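import Summits.QuantumFields.BalabanUV.T4Continuum.Support.SubstrateAvgTowerStructure
import Literature.MathematicalPhysics.QuantumFieldTheory.Balaban1983to89.T4AvgDerivBound
import Literature.MathematicalPhysics.QuantumFieldTheory.Balaban1983to89.B15DeterminingSets

/-!
# B13AvgCorrRefine — row NE5, κ-DISCHARGE programme (T4-DAG §8 Q49 (a′), dagwriter l.23165; design note
# `HOME/t4/b2b-balaban-t4-ne5-p1/g39/KAPPA-NE5-DESIGN.md` v0.1 §3), leaf κ-L3 «THE REFINED-LOOP IDENTITY» ((K1-a)):
# a loop holonomy of the averaging tower `U_i = (blockAvg ℰ)^i V` = ONE conjugated product of the accumulated corrections met along the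
# loop × the holonomy of `V` around the REFINED loop (the same closed curve read on the finest lattice), with the `dist1` budget of the first factor

Cell `pub-balaban`, NE5 formalisation swarm, unit `b2b-balaban-t4-ne5-formalise-leaf-02` (gen 25), for the row NE5 owner lineage `t4-ne5-p1` (κ's discharge owner per T4-DAG Q49 (a′)).  Summits-side NEW WORK under the LEAN
PLACEMENT RULE: [folklore] group algebra along lattice walks and word ∕ site bookkeeping across the levels of OUR tori (`Setup.emb`, `T4Continuum.walk`); no `Prop`-valued fact minted, nothing printed asserted, no citation tag.
HONEST FRAMING: rung (B)+1 of the FINITE-VOLUME T⁴ programme — NOT infinite volume, NOT a mass gap, NOT the Clay problem, NOT a proof of NE5 (NOT PRINTED; GAPS G-t4-U3-1); an identity + a subadditivity bound on OUR tower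
objects, nothing of [Balaban1985Averaging] ∕ [Balaban1987RG1] instantiated or discharged; the one-step letter `κ` of W-25a∕b is NOT discharged here (that is κ-END, from κ-L1…κ-L4).  HONEST DEPENDENCY (cell, verbatim): continuum
YM on T⁴ ⇐ BetaPertH ∧ nine spine estimates (0/9 proved); BetaPertH ⇐ (D1) ∧ (D4) ∧ CAP+tail; G-an2-4 gates asym, D1 and NE2/3/4.

WHY.  On the road of record (design note §2) the κ-letter `dist1 (corr ℰ U_i c) ≤ κ∕ℓ²` is reached from a bound on the loop variables `loopHol U_i c r = 𝒰(walk_{emb c₋}(loopWord L μ n σ σ′))(U_i)` of (0.4) at the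
level-`i` field `U_i = avgTower ℰ V i`.  By W-25a (`SubstrateAvgTowerStructure.avgTower_eq_corrAcc_mul_axialTower`) every level-`i` bond variable is `corrAcc ℰ V i b · axialTower V i b`, and the straight factor
`axialTower V i b` is the holonomy of `V` along the `L^i` finest bonds under `b`.  THIS FILE pulls the `corrAcc` factors (and the inverses met on backward letters) to the LEFT through an arbitrary walk — conjugation
does not change `dist1`, products are subadditive — and reads what is left on the finest lattice: the holonomy of `V` along the REFINED word (every letter repeated `L^i` times) from the iterated block centre. For
the loop words of (0.4) the refined word is AGAIN a loop word, `loopWord (L^i·L) μ (L^i·n) σ σ′` (`refineWord_loopWord`) — the junction with κ-L1's finest Stokes bound, which is stated for loop words of arbitrary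
segment length and offsets.
* §1 ([folklore], any `[GaugeGroup G]`, any step list `γ`): `corrHol C A γ` and **`holAt_mul_eq_corrHol_mul_holAt`** (`𝒰(γ)(C·A) = corrHol C A γ · 𝒰(γ)(A)`), **`dist1_corrHol_le`** (`≤ Σ_{s ∈ γ} dist1 (C s.bond)`),
  `dist1_corrHol_le_of_forall` (`≤ |γ|·a`). (W-25a's `conjAcc` ∕ `pprod_mul_eq_conjAcc_mul_pprod` is the all-forward, `ℕ`-indexed case; loops have backward letters, whence the step-list form.)
* §2 word refinement `refineWord N w` (each letter `N` times): `refineWord_append ∕ _replicate ∕ _wordRev ∕ _axisRun ∕ _stairWord`, **`refineWord_loopWord`** (`= loopWord (N·L) μ (N·n) σ σ′`), `length_refineWord`.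
* §3 the iterated block centre `embIter i : Site P i → Site P 0` (`Setup.emb` iterated) and **`embIter_shift`** (`embIter i (y + e_μ) = embIter i y + L^i e_μ`, as a `walkEnd`).
* §4 **`holAt_axialTower_walk`**: `𝒰(walk_y w)((axial)^i V) = 𝒰(walk_{embIter i y}(refineWord (L^i) w))(V)` — the axial tower read on the finest lattice.
* §5 **`holAt_avgTower_walk`** (the factorisation along any walk), the END **`loopHol_avgTower_eq`** and its `dist1` faces **`dist1_loopHol_avgTower_le`** (sum form) ∕ **`dist1_loopHol_avgTower_le_of_forall`** (`≤ (d+2)·L·a + dist1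
  (refined loop)` under a uniform `dist1 (corrAcc ℰ V i ·) ≤ a`, with `length_loopWord_off_le : |loopWord L μ (off r) σ σ′| ≤ (d+2)·L` and `T4AvgDerivBound.length_walk` BY NAME).
κ-END combines the last face with W-25a `dist1_corrAcc_le_of_hκ` (`a = 2κ∕(L^(K−i))²`), κ-L1 (finest Stokes on the refined loop word), κ-L2, κ-L4.
* §6 (v1.2, IF2-21 of `lit-balaban/INTERFACES.md` §2; ruling (σ4), concurrence journal l.24935): `embIter_eq_lit` BRIDGES §3's `embIter` to the Literature twin `B15DeterminingSets.embIter` (append-only — the gate refuses the `abbrev`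
  replacement; §3 stays byte-identical, consumers untouched).
0 sorry; axioms ⊆ {propext, Classical.choice, Quot.sound}.
-/

noncomputable section

open scoped BigOperators

namespace Summit.QuantumFields.BalabanUV.T4Continuum.B13AvgCorrRefine

open Literature.MathematicalPhysics.QuantumFieldTheory.Balaban1983to89
open Literature.MathematicalPhysics.QuantumFieldTheory.Balaban1983to89.T4Continuum (Letter LStep walk walkEnd holAt netDisp wordRev
  axisRun stairRuns stairWord loopWord walk_append walkEnd_append holAt_append holAt_nil holAt_cons holAt_walk_wordRev walkEnd_walkEnd_wordRev
  wordRev_append wordRev_replicate wordRev_cons wordRev_nil walkEnd_apply emb_shift_apply pathProd_eq_holAt_walk)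
open Literature.MathematicalPhysics.QuantumFieldTheory.Balaban1983to89.BlockAveraging (Idx off off_bounds loopHol)
open Literature.MathematicalPhysics.QuantumFieldTheory.Balaban1983to89.AveragingRT (pathProd)
open Summit.QuantumFields.BalabanUV.T4Continuum.SubstrateAvgTowerStructure (avgTower axialTower corrAcc avgTower_eq_corrAcc_mul_axialTower
  axialTower_succ)

/-! ## §1 Pulling left factors through a holonomy: the conjugated correction product of a step list -/

section Group

variable {P : Params} {j : ℕ} {G : Type*} [GaugeGroup G]

/-- [folklore] **THE CONJUGATED CORRECTION PRODUCT** of a step list for a bond field written as `C·A`: the factor collecting the `C(b)`'s (forward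
steps) and the conjugated `C(b)⁻¹`'s (backward steps) when they are pulled to the LEFT through the `A`-holonomy — `corrHol [] = 1`,
`corrHol (b⁺ :: γ) = C b · A b · corrHol γ · (A b)⁻¹`, `corrHol (b⁻ :: γ) = (A b)⁻¹ · (C b)⁻¹ · corrHol γ · A b`. -/
def corrHol (C A : GaugeField P j G) : List (LStep P j) → G
  | [] => 1
  | ⟨b, true⟩ :: γ => C b * A b * corrHol C A γ * (A b)⁻¹
  | ⟨b, false⟩ :: γ => (A b)⁻¹ * (C b)⁻¹ * corrHol C A γ * A b

/-- [folklore] `corrHol` of the empty list. -/ @[simp] theorem corrHol_nil (C A : GaugeField P j G) : corrHol C A [] = 1 := rfl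

/-- [folklore] `corrHol` at a forward step. -/
theorem corrHol_cons_true (C A : GaugeField P j G) (b : PBond P j) (γ : List (LStep P j)) :
    corrHol C A (⟨b, true⟩ :: γ) = C b * A b * corrHol C A γ * (A b)⁻¹ := rfl

/-- [folklore] `corrHol` at a backward step. -/
theorem corrHol_cons_false (C A : GaugeField P j G) (b : PBond P j) (γ : List (LStep P j)) :
    corrHol C A (⟨b, false⟩ :: γ) = (A b)⁻¹ * (C b)⁻¹ * corrHol C A γ * A b := rfl

/-- [folklore] **PULLING THE CORRECTIONS THROUGH A HOLONOMY**: `𝒰(γ)(b ↦ C b · A b) = corrHol C A γ · 𝒰(γ)(A)` for EVERY step list `γ`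
(forward and backward steps). -/
theorem holAt_mul_eq_corrHol_mul_holAt (C A : GaugeField P j G) :
    ∀ γ : List (LStep P j), holAt (fun b => C b * A b) γ = corrHol C A γ * holAt A γ
  | [] => by rw [holAt_nil, holAt_nil, corrHol_nil, one_mul]
  | ⟨b, true⟩ :: γ => by
      rw [holAt_cons, holAt_cons, corrHol_cons_true, holAt_mul_eq_corrHol_mul_holAt C A γ]
      simp only [if_true]
      group
  | ⟨b, false⟩ :: γ => by
      rw [holAt_cons, holAt_cons, corrHol_cons_false, holAt_mul_eq_corrHol_mul_holAt C A γ]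
      simp only [Bool.false_eq_true, if_false]
      group

/-- [folklore] **`dist1 (corrHol C A γ) ≤ Σ_{s ∈ γ} dist1 (C s.bond)`** — conjugation does not change `dist1` (`dist1_conj`), inversion neither
(`dist1_inv`), products are subadditive (`dist1_mul_le`); the factors `A` do not enter. -/
theorem dist1_corrHol_le (C A : GaugeField P j G) :
    ∀ γ : List (LStep P j), dist1 (corrHol C A γ) ≤ (γ.map fun s => dist1 (C s.bond)).sum
  | [] => by rw [corrHol_nil, GaugeGroup.dist1_one, List.map_nil, List.sum_nil]
  | ⟨b, true⟩ :: γ => by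
      rw [corrHol_cons_true, List.map_cons, List.sum_cons]
      have e : C b * A b * corrHol C A γ * (A b)⁻¹ = C b * (A b * corrHol C A γ * (A b)⁻¹) := by group
      rw [e]
      refine (GaugeGroup.dist1_mul_le _ _).trans (add_le_add le_rfl ?_)
      rw [GaugeGroup.dist1_conj]
      exact dist1_corrHol_le C A γ
  | ⟨b, false⟩ :: γ => by
      rw [corrHol_cons_false, List.map_cons, List.sum_cons]
      have e : (A b)⁻¹ * (C b)⁻¹ * corrHol C A γ * A b = (A b)⁻¹ * ((C b)⁻¹ * corrHol C A γ) * (A b)⁻¹⁻¹ := by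
        rw [inv_inv]; group
      rw [e, GaugeGroup.dist1_conj]
      refine (GaugeGroup.dist1_mul_le _ _).trans (add_le_add (le_of_eq (GaugeGroup.dist1_inv _)) ?_)
      exact dist1_corrHol_le C A γ

/-- [folklore] the uniform form: `dist1 (C b) ≤ a` for all bonds gives `dist1 (corrHol C A γ) ≤ |γ|·a`. -/
theorem dist1_corrHol_le_of_forall (C A : GaugeField P j G) {a : ℝ} (ha : ∀ b : PBond P j, dist1 (C b) ≤ a) (γ : List (LStep P j)) :
    dist1 (corrHol C A γ) ≤ (γ.length : ℝ) * a := by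
  refine (dist1_corrHol_le C A γ).trans ?_
  induction γ with
  | nil => simp
  | cons s γ ih =>
      rw [List.map_cons, List.sum_cons, List.length_cons, Nat.cast_succ, add_mul, one_mul, add_comm]
      exact add_le_add ih (ha s.bond)

end Group

/-! ## §2 Word refinement: every letter repeated `N` times -/

section Words

variable {d : ℕ}

/-- [folklore] **THE REFINED WORD**: each letter of `w` repeated `N` times — the same lattice curve read on an `N`-times finer lattice. -/
def refineWord (N : ℕ) (w : List (Letter d)) : List (Letter d) := w.flatMap fun l => List.replicate N l

/-- [folklore] refinement of the empty word. -/ @[simp] theorem refineWord_nil (N : ℕ) : refineWord N ([] : List (Letter d)) = [] := rfl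

/-- [folklore] refinement of a word with a first letter. -/
theorem refineWord_cons (N : ℕ) (l : Letter d) (w : List (Letter d)) : refineWord N (l :: w) = List.replicate N l ++ refineWord N w := by
  simp [refineWord]

/-- [folklore] refinement is a homomorphism for concatenation. -/
theorem refineWord_append (N : ℕ) (w₁ w₂ : List (Letter d)) : refineWord N (w₁ ++ w₂) = refineWord N w₁ ++ refineWord N w₂ := by
  simp [refineWord]

/-- [folklore] refinement by `1` is the identity. -/
theorem refineWord_one (w : List (Letter d)) : refineWord 1 w = w := by
  induction w with
  | nil => rfl
  | cons l w ih => rw [refineWord_cons, ih]; rfl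

/-- [folklore] a run refines to a run: `refineWord N (l^k) = l^{k·N}`. -/
theorem refineWord_replicate (N k : ℕ) (l : Letter d) : refineWord N (List.replicate k l) = List.replicate (k * N) l := by
  induction k with
  | zero => rw [Nat.zero_mul]; rfl
  | succ k ih => rw [List.replicate_succ, refineWord_cons, ih, Nat.succ_mul, add_comm, List.replicate_add]

/-- [folklore] refinement commutes with reversal. -/
theorem refineWord_wordRev (N : ℕ) (w : List (Letter d)) : refineWord N (wordRev w) = wordRev (refineWord N w) := by
  induction w with
  | nil => rfl
  | cons l w ih =>
      rw [wordRev_cons, refineWord_append, ih, refineWord_cons N l w, wordRev_append, wordRev_replicate, refineWord_cons, refineWord_nil,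
        List.append_nil]

/-- [folklore] the length of the refined word. -/
theorem length_refineWord (N : ℕ) (w : List (Letter d)) : (refineWord N w).length = w.length * N := by
  induction w with
  | nil => rw [refineWord_nil, List.length_nil, Nat.zero_mul]
  | cons l w ih => rw [refineWord_cons, List.length_append, List.length_replicate, ih, List.length_cons, Nat.succ_mul, add_comm]

/-- [folklore] an axis run refines to the axis run of the scaled displacement: `refineWord N (axisRun μ k) = axisRun μ (N·k)`. -/
theorem refineWord_axisRun (N : ℕ) (μ : Fin d) (k : ℤ) : refineWord N (axisRun μ k) = axisRun μ ((N : ℤ) * k) := by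
  unfold axisRun
  rw [refineWord_replicate, Int.natAbs_mul, Int.natAbs_natCast, mul_comm]
  rcases Nat.eq_zero_or_pos N with rfl | hN
  · simp
  · have h : (0 ≤ (N : ℤ) * k) ↔ (0 ≤ k) := mul_nonneg_iff_of_pos_left (by exact_mod_cast hN)
    simp only [decide_eq_decide.mpr h]

/-- [folklore] staircase runs refine to the staircase runs of the scaled displacements. -/
theorem refineWord_stairRuns (N : ℕ) (n : Fin d → ℤ) :
    ∀ as : List (Fin d), refineWord N (stairRuns n as) = stairRuns (fun ν => (N : ℤ) * n ν) as
  | [] => rfl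
  | a :: as => by
      show refineWord N (axisRun a (n a) ++ stairRuns n as) = axisRun a ((N : ℤ) * n a) ++ stairRuns (fun ν => (N : ℤ) * n ν) as
      rw [refineWord_append, refineWord_axisRun, refineWord_stairRuns N n as]

/-- [folklore] **a staircase word refines to the staircase word of the scaled offset**: `refineWord N (Γ^σ(n)) = Γ^σ(N·n)`. -/
theorem refineWord_stairWord (N : ℕ) (σ : Equiv.Perm (Fin d)) (n : Fin d → ℤ) :
    refineWord N (stairWord σ n) = stairWord σ (fun ν => (N : ℤ) * n ν) :=
  refineWord_stairRuns N n _

/-- [folklore] **THE REFINED LOOP WORD IS A LOOP WORD**: `refineWord N (loopWord L μ n σ σ′) = loopWord (N·L) μ (N·n) σ σ′` — the loop of (0.4) at a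
coarse bond, read on an `N`-times finer lattice, is the loop word with segment length `N·L` and offsets `N·n` (the junction with κ-L1's finest Stokes). -/
theorem refineWord_loopWord (N L : ℕ) (μ : Fin d) (n : Fin d → ℤ) (σ σ' : Equiv.Perm (Fin d)) :
    refineWord N (loopWord L μ n σ σ') = loopWord (N * L) μ (fun ν => (N : ℤ) * n ν) σ σ' := by
  unfold loopWord
  rw [refineWord_append, refineWord_append, refineWord_append, refineWord_stairWord, refineWord_replicate, refineWord_wordRev,
    refineWord_stairWord, refineWord_replicate, mul_comm L N]

/-- [folklore] the length of the staircase runs under a uniform bound on the displacements. -/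
theorem length_stairRuns_le (n : Fin d → ℤ) {h : ℕ} (hn : ∀ ν, (n ν).natAbs ≤ h) :
    ∀ as : List (Fin d), (stairRuns n as).length ≤ as.length * h
  | [] => by rw [List.length_nil, Nat.zero_mul]; exact le_of_eq rfl
  | a :: as => by
      show (axisRun a (n a) ++ stairRuns n as).length ≤ (as.length + 1) * h
      rw [List.length_append, axisRun, List.length_replicate, Nat.succ_mul, add_comm (as.length * h)]
      exact add_le_add (hn a) (length_stairRuns_le n hn as)

/-- [folklore] the length of a loop word: two segments of `L` letters and two staircases. -/
theorem length_loopWord (L : ℕ) (μ : Fin d) (n : Fin d → ℤ) (σ σ' : Equiv.Perm (Fin d)) :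
    (loopWord L μ n σ σ').length = (stairWord σ n).length + L + ((stairWord σ' n).length + L) := by
  unfold loopWord wordRev
  simp only [List.length_append, List.length_replicate, List.length_reverse, List.length_map]
  omega

end Words

/-- [folklore] **THE LOOP WORDS OF (0.4) HAVE AT MOST `(d+2)·L` LETTERS**: the offsets `n = off r` satisfy `|n_ν| ≤ (L−1)∕2` (`off_bounds`), so each
staircase has `≤ d·(L−1)∕2` letters and the loop `≤ 2L + d(L−1) ≤ (d+2)·L`. -/
theorem length_loopWord_off_le {P : Params} (μ : Fin P.d) (r : Fin P.d → Fin P.L) (σ σ' : Equiv.Perm (Fin P.d)) :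
    (loopWord P.L μ (off r) σ σ').length ≤ (P.d + 2) * P.L := by
  have hn : ∀ ν, (off r ν).natAbs ≤ (P.L - 1) / 2 := fun ν => by have h := off_bounds r ν; omega
  have hs : ∀ τ : Equiv.Perm (Fin P.d), (stairWord τ (off r)).length ≤ P.d * ((P.L - 1) / 2) := fun τ => by
    have h := length_stairRuns_le (off r) hn ((List.finRange P.d).map τ)
    rw [List.length_map, List.length_finRange] at h
    exact h
  have hL : 2 * ((P.L - 1) / 2) ≤ P.L := by have := P.hL.2; omega
  rw [length_loopWord]
  have h1 := hs σ; have h2 := hs σ'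
  have : P.d * ((P.L - 1) / 2) * 2 ≤ P.d * P.L := by rw [mul_assoc, mul_comm _ 2]; exact Nat.mul_le_mul_left _ hL
  nlinarith

/-! ## §3 Sites across the levels: the iterated block centre and its translation law -/

section Levels

variable {P : Params}

/-- [folklore] **THE ITERATED BLOCK CENTRE** `embIter i : T^{(i)} → T^{(0)}`: `Setup.emb` (the centre of the block, centred convention of
[Balaban1987RG1] (0.1)) iterated down to the finest lattice — `embIter 0 = id`, `embIter (i+1) y = embIter i (emb y)`. -/
def embIter : (i : ℕ) → Site P i → Site P 0
  | 0, y => y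
  | i + 1, y => embIter i (emb y)

/-- [folklore] `embIter` at level `0`. -/ @[simp] theorem embIter_zero (y : Site P 0) : embIter 0 y = y := rfl

/-- [folklore] `embIter` at a successor level. -/ theorem embIter_succ (i : ℕ) (y : Site P (i + 1)) : embIter (i + 1) y = embIter i (emb y) := rfl

/-- [folklore] **`emb (y + e_μ) = emb y + L e_μ`**, the right-hand side as the end of the straight walk of `L` letters `+e_μ`. -/
theorem emb_shift_eq_walkEnd {j : ℕ} (y : Site P (j + 1)) (μ : Fin P.d) :
    emb (y.shift μ) = walkEnd (emb y) (List.replicate P.L (μ, true)) := by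
  funext ν
  rw [emb_shift_apply, walkEnd_apply, T4ReflectionCone.netDisp_replicate]
  by_cases h : ν = μ
  · subst h; simp
  · simp [h, Ne.symm h]

/-- [folklore] `emb` of the end of a straight forward walk of `n` steps is the end of the straight walk of `n·L` steps from `emb y`. -/
theorem emb_walkEnd_replicate {j : ℕ} (μ : Fin P.d) :
    ∀ (n : ℕ) (y : Site P (j + 1)), emb (walkEnd y (List.replicate n (μ, true))) = walkEnd (emb y) (List.replicate (n * P.L) (μ, true))
  | 0, y => by simp [walkEnd]
  | n + 1, y => by
      show emb (walkEnd (y.shift μ) (List.replicate n (μ, true))) = _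
      rw [emb_walkEnd_replicate μ n (y.shift μ), emb_shift_eq_walkEnd, ← walkEnd_append, ← List.replicate_add, Nat.succ_mul, add_comm]

/-- [folklore] `embIter` of the end of a straight forward walk of `n` level-`i` steps is the end of the straight walk of `n·L^i` finest steps. -/
theorem embIter_walkEnd_replicate (μ : Fin P.d) :
    ∀ (i n : ℕ) (y : Site P i), embIter i (walkEnd y (List.replicate n (μ, true))) = walkEnd (embIter i y) (List.replicate (n * P.L ^ i) (μ, true))
  | 0, n, y => by simp
  | i + 1, n, y => by
      rw [embIter_succ, emb_walkEnd_replicate, embIter_walkEnd_replicate μ i, embIter_succ, pow_succ, mul_assoc, mul_comm (P.L ^ i) P.L]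

/-- [folklore] **`embIter i (y + e_μ) = embIter i y + L^i e_μ`** (as the end of the straight walk of `L^i` letters `+e_μ`). -/
theorem embIter_shift (i : ℕ) (y : Site P i) (μ : Fin P.d) :
    embIter i (y.shift μ) = walkEnd (embIter i y) (List.replicate (P.L ^ i) (μ, true)) := by
  have h := embIter_walkEnd_replicate μ i 1 y
  rwa [one_mul] at h

end Levels

/-! ## §4 The axial tower read on the finest lattice -/

section Axial

variable {P : Params} {G : Type*} [GaugeGroup G]

/-- [folklore] **THE AXIAL TOWER ALONG A WALK IS THE FINEST HOLONOMY ALONG THE REFINED WALK**: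
`𝒰(walk_y w)((axial)^i V) = 𝒰(walk_{embIter i y}(refineWord (L^i) w))(V)` for every level `i`, base `y` and word `w` (forward and backward letters). -/
theorem holAt_axialTower_walk (V : GaugeField P 0 G) :
    ∀ (i : ℕ) (y : Site P i) (w : List (Letter P.d)),
      holAt (axialTower V i) (walk y w) = holAt V (walk (embIter i y) (refineWord (P.L ^ i) w))
  | 0, y, w => by rw [pow_zero, refineWord_one, embIter_zero]; rfl
  | i + 1, y, w => by
      -- a single level-`(i+1)` bond, from the statement at level `i` along the straight line of `L` level-`i` bonds
      have hb : ∀ (z : Site P (i + 1)) (μ : Fin P.d),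
          axialTower V (i + 1) ⟨z, μ⟩ = holAt V (walk (embIter (i + 1) z) (List.replicate (P.L ^ (i + 1)) (μ, true))) := by
        intro z μ
        rw [axialTower_succ, pathProd_eq_holAt_walk, holAt_axialTower_walk V i, refineWord_replicate, embIter_succ, pow_succ']
      induction w generalizing y with
      | nil => simp only [walk, refineWord_nil, holAt_nil]
      | cons l w ih =>
          obtain ⟨μ, b⟩ := l
          cases b
          · -- backward letter `−e_μ`: the bond `⟨y − e_μ, μ⟩` traversed backwards
            have hw : walk y ((μ, false) :: w) = ⟨⟨y.unshift μ, μ⟩, false⟩ :: walk (y.unshift μ) w := rfl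
            have hflip : wordRev (List.replicate (P.L ^ (i + 1)) ((μ, true) : Letter P.d)) = List.replicate (P.L ^ (i + 1)) (μ, false) :=
              wordRev_replicate _ _
            have hend : walkEnd (embIter (i + 1) (y.unshift μ)) (List.replicate (P.L ^ (i + 1)) (μ, true)) = embIter (i + 1) y := by
              rw [← embIter_shift, Site.shift_unshift]
            have hback : walkEnd (embIter (i + 1) y) (List.replicate (P.L ^ (i + 1)) (μ, false)) = embIter (i + 1) (y.unshift μ) := by
              rw [← hend, ← hflip, walkEnd_walkEnd_wordRev]
            rw [hw, holAt_cons, refineWord_cons, walk_append, holAt_append, ih (y.unshift μ), hback]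
            simp only [Bool.false_eq_true, if_false]
            rw [hb, ← hend, ← holAt_walk_wordRev, hflip, hend]
          · -- forward letter `+e_μ`: the bond `⟨y, μ⟩`
            have hw : walk y ((μ, true) :: w) = ⟨⟨y, μ⟩, true⟩ :: walk (y.shift μ) w := rfl
            rw [hw, holAt_cons, refineWord_cons, walk_append, holAt_append, ih (y.shift μ), embIter_shift]
            simp only [if_true]
            rw [hb]

/-- [folklore] a single bond: `(axial)^i V ⟨y, μ⟩` is the holonomy of `V` along the `L^i` finest bonds from `embIter i y` in direction `μ`. -/
theorem axialTower_eq_holAt_walk (V : GaugeField P 0 G) (i : ℕ) (b : PBond P i) :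
    axialTower V i b = holAt V (walk (embIter i b.src) (List.replicate (P.L ^ i) (b.dir, true))) := by
  have h := holAt_axialTower_walk V i b.src [(b.dir, true)]
  rw [refineWord_cons, refineWord_nil, List.append_nil] at h
  rw [← h]
  show axialTower V i b = holAt (axialTower V i) [⟨⟨b.src, b.dir⟩, true⟩]
  rw [holAt_cons, holAt_nil, mul_one]
  simp

end Axial

/-! ## §5 The averaging tower along a walk; the loop variables of (0.4) at level `i` -/

section Avg

variable {P : Params} {G : Type*} [GaugeGroup G] (ℰ : LoopAverage G)

/-- [folklore] **THE AVERAGING TOWER ALONG A WALK = CONJUGATED CORRECTIONS × REFINED FINEST HOLONOMY**: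
`𝒰(walk_y w)((blockAvg ℰ)^i V) = corrHol (corrAcc ℰ V i) ((axial)^i V) (walk_y w) · 𝒰(walk_{embIter i y}(refineWord (L^i) w))(V)`. -/
theorem holAt_avgTower_walk (V : GaugeField P 0 G) (i : ℕ) (y : Site P i) (w : List (Letter P.d)) :
    holAt (avgTower ℰ V i) (walk y w) =
      corrHol (corrAcc ℰ V i) (axialTower V i) (walk y w) * holAt V (walk (embIter i y) (refineWord (P.L ^ i) w)) := by
  have e : avgTower ℰ V i = fun b => corrAcc ℰ V i b * axialTower V i b := funext (avgTower_eq_corrAcc_mul_axialTower ℰ V i)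
  rw [e, holAt_mul_eq_corrHol_mul_holAt, holAt_axialTower_walk]

/-- [folklore] **THE REFINED-LOOP IDENTITY (κ-L3, design note (K1-a))**: the loop variable of (0.4) at the coarse bond `c` of `T^{(i+1)}` in the
level-`i` averaged field `U_i = (blockAvg ℰ)^i V` is ONE conjugated product of the accumulated corrections `corrAcc ℰ V i` met along the loop, times the
holonomy of the finest field `V` around the REFINED loop — the loop word with segment length `L^(i+1)` and offsets `L^i·n` from the iterated centre
`embIter (i+1) c₋`. -/
theorem loopHol_avgTower_eq (V : GaugeField P 0 G) (i : ℕ) (c : PBond P (i + 1)) (r : Idx P) :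
    loopHol (avgTower ℰ V i) c r =
      corrHol (corrAcc ℰ V i) (axialTower V i) (walk (emb c.src) (loopWord P.L c.dir (off r.1) r.2.1 r.2.2)) *
        holAt V (walk (embIter (i + 1) c.src) (loopWord (P.L ^ (i + 1)) c.dir (fun ν => ((P.L : ℤ) ^ i) * off r.1 ν) r.2.1 r.2.2)) := by
  unfold loopHol
  rw [holAt_avgTower_walk, refineWord_loopWord, embIter_succ, pow_succ]
  push_cast
  rfl

/-- [folklore] **THE `dist1` FACE OF THE REFINED-LOOP IDENTITY (sum form)**:
`dist1 (loopHol U_i c r) ≤ Σ_{s ∈ loop} dist1 (corrAcc ℰ V i s.bond) + dist1 (𝒰(refined loop)(V))`. -/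
theorem dist1_loopHol_avgTower_le (V : GaugeField P 0 G) (i : ℕ) (c : PBond P (i + 1)) (r : Idx P) :
    dist1 (loopHol (avgTower ℰ V i) c r) ≤
      ((walk (emb c.src) (loopWord P.L c.dir (off r.1) r.2.1 r.2.2)).map fun s => dist1 (corrAcc ℰ V i s.bond)).sum +
        dist1 (holAt V (walk (embIter (i + 1) c.src) (loopWord (P.L ^ (i + 1)) c.dir (fun ν => ((P.L : ℤ) ^ i) * off r.1 ν) r.2.1 r.2.2))) := by
  rw [loopHol_avgTower_eq]
  exact (GaugeGroup.dist1_mul_le _ _).trans (add_le_add (dist1_corrHol_le _ _ _) le_rfl)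

/-- [folklore] **THE `dist1` FACE OF THE REFINED-LOOP IDENTITY (uniform form, the shape κ-END consumes)**: under a uniform budget
`dist1 (corrAcc ℰ V i b) ≤ a` on the level-`i` accumulated corrections (W-25a `dist1_corrAcc_le_of_hκ`: `a = 2κ∕(L^(K−i))²`),
`dist1 (loopHol U_i c r) ≤ (d+2)·L·a + dist1 (𝒰(refined loop)(V))` — the first term carries ONE factor `L` against the `L²` gained by the coarser
scale, the second is κ-L1's (finest Stokes on `loopWord (L^(i+1)) μ (L^i·n) σ σ′`). -/
theorem dist1_loopHol_avgTower_le_of_forall (V : GaugeField P 0 G) (i : ℕ) {a : ℝ} (ha : ∀ b : PBond P i, dist1 (corrAcc ℰ V i b) ≤ a)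
    (c : PBond P (i + 1)) (r : Idx P) :
    dist1 (loopHol (avgTower ℰ V i) c r) ≤
      ((P.d + 2) * P.L : ℕ) * a +
        dist1 (holAt V (walk (embIter (i + 1) c.src) (loopWord (P.L ^ (i + 1)) c.dir (fun ν => ((P.L : ℤ) ^ i) * off r.1 ν) r.2.1 r.2.2))) := by
  have ha0 : 0 ≤ a := (GaugeGroup.dist1_nonneg _).trans (ha ⟨default, ⟨0, P.hd⟩⟩)
  rw [loopHol_avgTower_eq]
  refine (GaugeGroup.dist1_mul_le _ _).trans (add_le_add ?_ le_rfl)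
  refine (dist1_corrHol_le_of_forall _ _ ha _).trans (mul_le_mul_of_nonneg_right ?_ ha0)
  rw [T4AvgDerivBound.length_walk]
  exact_mod_cast length_loopWord_off_le c.dir r.1 r.2.1 r.2.2

end Avg

section Interface

variable {P : Params}

/-- [folklore] **§6 IF2-21 BRIDGE**: §3's `embIter` IS the Literature's `B15DeterminingSets.embIter` ([Balaban1987RG1] (0.1), the iterated block centre; same
two-clause recursion) — pointwise; new code should use the Literature def. -/
theorem embIter_eq_lit : ∀ (i : ℕ) (y : Site P i),
    embIter i y = Literature.MathematicalPhysics.QuantumFieldTheory.Balaban1983to89.B15DeterminingSets.embIter i y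
  | 0, _ => rfl
  | i + 1, y => by rw [embIter_succ, embIter_eq_lit i (emb y)]; rfl

end Interface

end Summit.QuantumFields.BalabanUV.T4Continuum.B13AvgCorrRefine

end
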